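import Summits.AtomisticToContinuum.Crystallization.Theses.TwoCentreKissingKernel
import Literature.MathematicalPhysics.StatisticalMechanics.LennardJonesClusters

/-!
# Route `TwoCentreKissingKernel`, item stmt-AtomisticToContinuum-12084 `BondToShells`

The glue `BondOrderTwelve → GapFreeShellRigidity → LocalClosePacking` of route
`TwoCentreKissingKernel` (sub-problem `Crystallization`).

## Proof

Take for `LocalClosePacking` the bond length `a > 0` of `BondOrderTwelve` and write `ε = 10⁻³`.
Fix a configuration `x : Fin N → ℝ³` and call a particle `i` *good* if `(1-ε)a ≤ dist xᵢ xⱼ` for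
every `j ≠ i` and exactly twelve `j ≠ i` have `dist xᵢ xⱼ ≤ (1+ε)a` (the complement of the set
counted by `BondOrderTwelve`), and *close-packed* if its rescaled soft first shell is `1/10`-close
to the FCC or the HCP kissing pattern (the complement of the set counted by `LocalClosePacking`).

* `BondToShells.closePacked_of_good` — if every particle within `4a` of `xᵢ` is good, the rescaled
  configuration `S = {a⁻¹(xⱼ - xᵢ) : j}` satisfies the hypotheses of `GapFreeShellRigidity` at
  `η = ε` about `0 ∈ S`, and the kernel's conclusion is literally close-packedness of `i`.  A good
  particle is at positive distance from every other particle, which is all the injectivity the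
  bookkeeping between index sets and point sets needs (the ground-state property is not used).
* `BondToShells.card_good_near_le` — good particles within `4a` of a point are pairwise
  `(1-ε)a`-separated, so by the volume packing bound
  `Literature.MathematicalPhysics.StatisticalMechanics.card_le_of_separated_of_dist_le` there are
  at most `(8/(1-ε) + 1)³ ≤ 1000` of them.
* `BondToShells.card_not_le` — a non-close-packed particle is bad or is a good particle within
  `4a` of a bad one, so `#{not close-packed} ≤ (1000 + 1) · #{bad}` (abstract double count
  `BondToShells.card_not_le_of_local`).
* `bondToShells_proof` — divide by `N` and squeeze (`squeeze_zero`).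
-/

namespace Summit.AtomisticToContinuum.Crystallization.Theorems

open Summit.AtomisticToContinuum.Crystallization.Theses.TwoCentreKissingKernel
open Literature.Geometry.DiscreteGeometry

namespace BondToShells

/-- Abstract double count: if `cp i` holds whenever every `j` near `i` is good, and at most `K`
good indices are near any bad index, then the indices failing `cp` number at most `(K + 1)` times
the bad indices (each is bad itself, or good and near a bad one). -/
theorem card_not_le_of_local {ι : Type*} [Fintype ι] {good cp : ι → Prop} {near : ι → ι → Prop}
    {K : ℕ} (hcp : ∀ i, (∀ j, near i j → good j) → cp i)
    (hnear : ∀ j, ¬ good j → Nat.card {i // good i ∧ near i j} ≤ K) :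
    Nat.card {i // ¬ cp i} ≤ (K + 1) * Nat.card {i // ¬ good i} := by
  classical
  set B : Finset ι := Finset.univ.filter fun i => ¬ good i with hB
  set G : ι → Finset ι := fun j => Finset.univ.filter fun i => good i ∧ near i j with hG
  have hBc : Nat.card {i // ¬ good i} = B.card := Nat.subtype_card B (by simp [hB])
  have hCc : Nat.card {i // ¬ cp i} = (Finset.univ.filter fun i => ¬ cp i).card :=
    Nat.subtype_card _ (by simp)
  have hGc : ∀ j, Nat.card {i // good i ∧ near i j} = (G j).card := fun j =>
    Nat.subtype_card _ (by simp [hG])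
  have hsub : (Finset.univ.filter fun i => ¬ cp i) ⊆ B ∪ B.biUnion G := by
    intro i hi
    simp only [Finset.mem_filter, Finset.mem_univ, true_and] at hi
    rw [Finset.mem_union, Finset.mem_biUnion]
    by_cases hgi : good i
    · right
      by_contra h
      push Not at h
      refine hi (hcp i fun j hj => ?_)
      by_contra hgj
      exact h j (by simp [hB, hgj]) (by simp [hG, hgi, hj])
    · left
      simp [hB, hgi]
  rw [hCc, hBc]
  calc (Finset.univ.filter fun i => ¬ cp i).card ≤ (B ∪ B.biUnion G).card :=
        Finset.card_le_card hsub
    _ ≤ B.card + (B.biUnion G).card := Finset.card_union_le _ _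
    _ ≤ B.card + ∑ j ∈ B, (G j).card := by
        gcongr
        exact Finset.card_biUnion_le
    _ ≤ B.card + ∑ j ∈ B, K := by
        gcongr with j hj
        rw [← hGc]
        exact hnear j (by simpa [hB] using hj)
    _ = (K + 1) * B.card := by
        rw [Finset.sum_const, smul_eq_mul]
        ring

/-- The geometric step.  If every particle within `4a` of `xᵢ` is good (separated by `(1-10⁻³)a`
from all other particles, exactly twelve others within `(1+10⁻³)a`), then `GapFreeShellRigidity`,
applied at tolerance `10⁻³` to the rescaled configuration `{a⁻¹(xⱼ - xᵢ)}` about `0`, shows that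
the rescaled soft first shell of `i` is `1/10`-close to the FCC or the HCP kissing pattern. -/
theorem closePacked_of_good (hGap : GapFreeShellRigidity) {N : ℕ}
    (x : Fin N → EuclideanSpace ℝ (Fin 3)) {a : ℝ} (ha : 0 < a) (i : Fin N)
    (hgood : ∀ j : Fin N, dist (x i) (x j) ≤ 4 * a →
      (∀ k : Fin N, k ≠ j → (1 - 1 / 1000) * a ≤ dist (x j) (x k)) ∧
        Nat.card {k : Fin N // k ≠ j ∧ dist (x j) (x k) ≤ (1 + 1 / 1000) * a} = 12) :
    ∃ T : Finset (EuclideanSpace ℝ (Fin 3)), (↑T : Set (EuclideanSpace ℝ (Fin 3))) =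
        (fun j : Fin N => a⁻¹ • (x j - x i)) ''
          {j : Fin N | j ≠ i ∧ dist (x i) (x j) ≤ (1 + 1 / 1000) * a} ∧
      (ShellCloseTo (1 / 10) T fccKissingPattern ∨ ShellCloseTo (1 / 10) T hcpKissingPattern) := by
  set φ : Fin N → EuclideanSpace ℝ (Fin 3) := fun j => a⁻¹ • (x j - x i) with hφ
  have hdist : ∀ j k, dist (φ j) (φ k) = a⁻¹ * dist (x j) (x k) := by
    intro j k
    simp only [hφ, dist_smul₀, norm_inv, Real.norm_eq_abs, abs_of_pos ha, dist_sub_right]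
  have hφi : φ i = 0 := by simp [hφ]
  have hdist0 : ∀ j, dist (0 : EuclideanSpace ℝ (Fin 3)) (φ j) = a⁻¹ * dist (x i) (x j) := by
    intro j
    rw [← hφi, hdist]
  have hle : ∀ {d c : ℝ}, a⁻¹ * d ≤ c ↔ d ≤ c * a := fun {d c} => by
    rw [inv_mul_le_iff₀ ha, mul_comm]
  have hge : ∀ {d c : ℝ}, c ≤ a⁻¹ * d ↔ c * a ≤ d := fun {d c} => by
    rw [le_inv_mul_iff₀ ha, mul_comm]
  -- a good particle is distinct from every other particle
  have hne_of_good : ∀ j, dist (x i) (x j) ≤ 4 * a → ∀ k, k ≠ j → x k ≠ x j := by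
    intro j hj k hk h
    have h1 := (hgood j hj).1 k hk
    rw [h, dist_self] at h1
    nlinarith
  -- `φ` identifies points only when `x` does
  have hφinj : ∀ j k, φ j = φ k → x j = x k := by
    intro j k h
    have h' := smul_right_injective (EuclideanSpace ℝ (Fin 3)) (inv_ne_zero ha.ne') h
    simpa using h'
  have hi4 : dist (x i) (x i) ≤ 4 * a := by
    rw [dist_self]
    positivity
  have hsep : ∀ y ∈ Set.range φ, ∀ y' ∈ Set.range φ, dist 0 y ≤ 4 → dist 0 y' ≤ 4 → y ≠ y' →
      1 - 1 / 1000 ≤ dist y y' := by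
    rintro y ⟨j, rfl⟩ y' ⟨k, rfl⟩ hj _ hne
    have hkj : k ≠ j := fun h => hne (h ▸ rfl)
    have hj4 : dist (x i) (x j) ≤ 4 * a := by
      rw [hdist0] at hj
      exact hle.1 hj
    rw [hdist]
    exact hge.2 ((hgood j hj4).1 k hkj)
  have hcount : ∀ y ∈ Set.range φ, dist 0 y ≤ 1 + 1 / 1000 →
      {w ∈ Set.range φ | w ≠ y ∧ dist y w ≤ 1 + 1 / 1000}.ncard = 12 := by
    rintro y ⟨j, rfl⟩ hj
    have hj' : dist (x i) (x j) ≤ (1 + 1 / 1000) * a := by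
      rw [hdist0] at hj
      exact hle.1 hj
    have hj4 : dist (x i) (x j) ≤ 4 * a := by nlinarith [dist_nonneg (x := x i) (y := x j)]
    have hset : {w ∈ Set.range φ | w ≠ φ j ∧ dist (φ j) w ≤ 1 + 1 / 1000} =
        φ '' {k : Fin N | k ≠ j ∧ dist (x j) (x k) ≤ (1 + 1 / 1000) * a} := by
      ext w
      simp only [Set.mem_setOf_eq, Set.mem_range, Set.mem_image]
      constructor
      · rintro ⟨⟨k, rfl⟩, hne, hd⟩
        refine ⟨k, ⟨fun h => hne (h ▸ rfl), ?_⟩, rfl⟩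
        rw [hdist] at hd
        exact hle.1 hd
      · rintro ⟨k, ⟨hkj, hd⟩, rfl⟩
        refine ⟨⟨k, rfl⟩, fun h => hne_of_good j hj4 k hkj (hφinj k j h), ?_⟩
        rw [hdist]
        exact hle.2 hd
    have hinj : Set.InjOn φ {k : Fin N | k ≠ j ∧ dist (x j) (x k) ≤ (1 + 1 / 1000) * a} := by
      rintro k ⟨-, hkd⟩ k' ⟨-, -⟩ h
      by_contra hne
      have hk4 : dist (x i) (x k) ≤ 4 * a := by
        have := dist_triangle (x i) (x j) (x k)
        nlinarith
      exact hne_of_good k hk4 k' (Ne.symm hne) (hφinj k' k h.symm)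
    rw [hset, hinj.ncard_image, ← Nat.card_coe_set_eq]
    exact (hgood j hj4).2
  obtain ⟨T, hT, hclose⟩ :=
    hGap (1 / 1000) (by norm_num) le_rfl (Set.range φ) 0 ⟨i, hφi⟩ hsep hcount
  refine ⟨T, ?_, hclose⟩
  rw [hT]
  ext w
  simp only [Set.mem_image, Set.mem_setOf_eq, Set.mem_range, sub_zero]
  constructor
  · rintro ⟨y, ⟨⟨j, rfl⟩, hy0, hyd⟩, rfl⟩
    refine ⟨j, ⟨?_, ?_⟩, rfl⟩
    · rintro rfl
      exact hy0 hφi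
    · rw [hdist0] at hyd
      exact hle.1 hyd
  · rintro ⟨j, ⟨hji, hjd⟩, rfl⟩
    refine ⟨φ j, ⟨⟨j, rfl⟩, fun h => hne_of_good i hi4 j hji (hφinj j i (h.trans hφi.symm)), ?_⟩,
      rfl⟩
    rw [hdist0]
    exact hle.2 hjd

/-- The packing step.  Good particles (separated by `(1-10⁻³)a` from all other particles) within
`4a` of a point `p` are pairwise `(1-10⁻³)a`-separated distinct points of the ball of radius `4a`
about `p`, hence number at most `(8/(1-10⁻³) + 1)³ ≤ 1000` by the volume packing bound. -/
theorem card_good_near_le {N : ℕ} (x : Fin N → EuclideanSpace ℝ (Fin 3)) {a : ℝ} (ha : 0 < a)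
    (p : EuclideanSpace ℝ (Fin 3)) (G : Finset (Fin N))
    (hG : ∀ i ∈ G, dist (x i) p ≤ 4 * a ∧
      ∀ j : Fin N, j ≠ i → (1 - 1 / 1000) * a ≤ dist (x i) (x j)) :
    G.card ≤ 1000 := by
  classical
  have hr : (0 : ℝ) < (1 - 1 / 1000) * a := mul_pos (by norm_num) ha
  have hinj : Set.InjOn x ↑G := by
    intro i hi i' hi' h
    by_contra hne
    have h1 := (hG i hi).2 i' (Ne.symm hne)
    rw [h, dist_self] at h1
    exact absurd h1 (not_le.2 hr)
  have hcard : (G.image x).card = G.card := Finset.card_image_of_injOn hinj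
  have key := Literature.MathematicalPhysics.StatisticalMechanics.card_le_of_separated_of_dist_le
    (G.image x) p hr (by positivity : (0 : ℝ) ≤ 4 * a) ?_ ?_
  · rw [hcard, finrank_euclideanSpace_fin] at key
    have h2 : (2 * (4 * a) / ((1 - 1 / 1000) * a) + 1) ^ 3 ≤ (1000 : ℝ) := by
      have h3 : 2 * (4 * a) / ((1 - 1 / 1000) * a) = 8000 / 999 := by
        field_simp
        ring
      rw [h3]
      norm_num
    exact_mod_cast key.trans h2
  · intro c hc
    obtain ⟨i, hi, rfl⟩ := Finset.mem_image.1 hc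
    exact (hG i hi).1
  · intro c hc d hd hcd
    obtain ⟨i, hi, rfl⟩ := Finset.mem_image.1 hc
    obtain ⟨i', hi', rfl⟩ := Finset.mem_image.1 hd
    exact (hG i hi).2 i' fun h => hcd (h ▸ rfl)

/-- The counting step, for one configuration: the particles whose rescaled soft first shell is not
`1/10`-close to the FCC or the HCP kissing pattern number at most `1001` times the particles that
fail the bond-order predicate of `BondOrderTwelve`. -/
theorem card_not_le (hGap : GapFreeShellRigidity) {N : ℕ} (x : Fin N → EuclideanSpace ℝ (Fin 3))
    {a : ℝ} (ha : 0 < a) :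
    Nat.card {i : Fin N // ¬ ∃ T : Finset (EuclideanSpace ℝ (Fin 3)),
        (↑T : Set (EuclideanSpace ℝ (Fin 3))) = (fun j : Fin N => a⁻¹ • (x j - x i)) ''
          {j : Fin N | j ≠ i ∧ dist (x i) (x j) ≤ (1 + 1 / 1000) * a} ∧
        (ShellCloseTo (1 / 10) T fccKissingPattern ∨ ShellCloseTo (1 / 10) T hcpKissingPattern)}
      ≤ 1001 * Nat.card {i : Fin N // ¬ ((∀ j : Fin N, j ≠ i → (1 - 1 / 1000) * a ≤
          dist (x i) (x j)) ∧
        Nat.card {j : Fin N // j ≠ i ∧ dist (x i) (x j) ≤ (1 + 1 / 1000) * a} = 12)} := by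
  classical
  refine card_not_le_of_local (near := fun i j => dist (x i) (x j) ≤ 4 * a) (K := 1000)
    (fun i hi => closePacked_of_good hGap x ha i hi) fun j _ => ?_
  rw [Nat.subtype_card (Finset.univ.filter fun i =>
      ((∀ k : Fin N, k ≠ i → (1 - 1 / 1000) * a ≤ dist (x i) (x k)) ∧
        Nat.card {k : Fin N // k ≠ i ∧ dist (x i) (x k) ≤ (1 + 1 / 1000) * a} = 12) ∧
      dist (x i) (x j) ≤ 4 * a) (by simp)]
  refine card_good_near_le x ha (x j) _ fun i hi => ?_
  simp only [Finset.mem_filter, Finset.mem_univ, true_and] at hi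
  exact ⟨hi.2, hi.1.1⟩

end BondToShells

/-- **Item stmt-AtomisticToContinuum-12084** (`BondToShells`, route `TwoCentreKissingKernel`):
`BondOrderTwelve → GapFreeShellRigidity → LocalClosePacking`, with the same bond length `a`.
Per configuration the non-close-packed particles number at most `1001` times the bond-bad ones
(`BondToShells.card_not_le`), so their fraction tends to `0` with the bad fraction. -/
theorem bondToShells_proof : BondToShells := by
  unfold BondToShells
  intro hB hGap
  obtain ⟨a, ha, hBa⟩ := hB
  refine ⟨a, ha, fun x hx => ?_⟩
  have hlim := (hBa x hx).const_mul (1001 : ℝ)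
  rw [mul_zero] at hlim
  refine squeeze_zero (fun N => by positivity) (fun N => ?_) hlim
  have h := BondToShells.card_not_le hGap (x N) ha
  have h' : (Nat.card {i : Fin N // ¬ ∃ T : Finset (EuclideanSpace ℝ (Fin 3)),
      (↑T : Set (EuclideanSpace ℝ (Fin 3))) = (fun j : Fin N => a⁻¹ • (x N j - x N i)) ''
        {j : Fin N | j ≠ i ∧ dist (x N i) (x N j) ≤ (1 + 1 / 1000) * a} ∧
      (ShellCloseTo (1 / 10) T fccKissingPattern ∨ ShellCloseTo (1 / 10) T hcpKissingPattern)} : ℝ)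
      ≤ 1001 * Nat.card {i : Fin N // ¬ ((∀ j : Fin N, j ≠ i → (1 - 1 / 1000) * a ≤
          dist (x N i) (x N j)) ∧
        Nat.card {j : Fin N // j ≠ i ∧ dist (x N i) (x N j) ≤ (1 + 1 / 1000) * a} = 12)} := by
    exact_mod_cast h
  calc _ ≤ _ := div_le_div_of_nonneg_right h' (Nat.cast_nonneg N)
    _ = _ := mul_div_assoc _ _ _

end Summit.AtomisticToContinuum.Crystallization.Theorems
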